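import Summits.BirchSwinnertonDyer.BirchSwinnertonDyer.Theorems.CongruentShaFreeCutBDPUpToSeriesRigidity
import HarnessLib

/-!
# BDP frames ACROSS PERIODS generate the SAME ideal of `R₀⟦T⟧` (integral cross-period rigidity, any
# prime `p`), and the `∃`-frame ⇒ `∀`-frame transfer for identities / memberships / inclusions of ideals
# — the currency of clause (ii) of crux #3 `TwinSplitIMCAtThree` (item stmt-BirchSwinnertonDyer-20214)
# and of crux #2 `ToricTransportModThree` of route `UniversalToricDescent`

Seat `bsd-wall-utd-p2` (D-0131 (3) MIDDLE tier), memo `HOME/bsd-wall/bsd-wall-utd-p2/SUPSET-AT3-v1.md`,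
finding F2 and its repair (A) — here PROVED, by composing cell bsd-cn100's LEMMA R∞
(`CongruentShaFreeCutBDPUpToSeriesRigidity.seriesRigidity_of_isBDPLFunctionUpTo`: two frames of the same
`(ι, 𝔭, κ, γ, f)` satisfy `p^a·L′ = p^b·(w·L)`, `w` a unit — RATIONAL rigidity, any prime) with one
evaluation argument that forces `a = b`. Kernel-checked, sorry-free; §1–§2 carry NO named fact.

* §1 `span_singleton_eq_of_isBDPLFunction` (any prime `p`; `K` imaginary quadratic, `κ` anticyclotomic,
  `γ` a topological generator; periods `Ω_K, Ω′_K ∈ ℂˣ`, `Ω_p, Ω′_p ∈ ℂ_pˣ` ARBITRARY): two series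
  `L, L′ ∈ R₀⟦T⟧` with `IsBDPLFunction ι 𝔭 κ γ f Ω_K Ω_p L` and `IsBDPLFunction ι 𝔭 κ γ f Ω′_K Ω′_p L′`
  generate the same ideal: `Ideal.span {L′} = Ideal.span {L}`. Proof: if `L = 0` then `L′ = 0` (cn100
  §1). Otherwise `p^a L′ = p^b (w L)`; evaluate at the supplied interpolation points `x_k = x₀^{p^k} − 1 → 0`
  (cn100's `characterSupplyAt`): the first frame has value `V_k`, the second `V_k·β^{m p^k}`
  (`X11b.hasValueAt_frame_rescale`), `w` has values of norm `1`; `V_k ≠ 0` for infinitely many `k`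
  (identity principle), so `‖p‖^a ‖β‖^{m p^k} = ‖p‖^b` at two indices `k₁ < k₂`, whence
  `‖β‖^{m p^{k₁}} = 1` and `a = b`; cancel `p^a` in the domain `R₀⟦T⟧`: `L′ = w L`.
* §2 consequences in the currency of clause (ii) (any ideal `I ⊆ R₀⟦T⟧`): membership / equality /
  inclusion transfer from ONE frame to EVERY frame (`mem_of_frame_of_frame`, `eq_span_of_frame_of_frame`,
  `le_span_of_frame_of_frame`), and `forall_frame_eq_span_of_exists` — an `∃`-frame identity `I = (L)`
  gives the `∀`-frame identity: the `∀`-frame quantification of 20214 (ii) / 20186 is HONEST (costs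
  exactly one frame), superseding the memo's F2 caveat.
* The crux-level corollaries at `p = 3` (the `⊇`-half at EVERY frame for good-ordinary twins; crux #3
  on such twins ⟸ the `⊆`-half at ONE frame) are the companion file
  `UniversalToricDescentTwinSplitIMCAtThreeEveryFrame.lean` (it needs the route file; this one does not).

Beyond-print: elementary `p`-adic algebra assembled from tree theorems (cn100 R∞ + X11b rescale); not a
BSD statement; imports no `Theses` module. `--supports stmt-BirchSwinnertonDyer-20214`.

References: [Castella2018] Thm. 3.1 (arXiv:1704.06608 p. 9); [Washington1997] §7.1–7.2;
[BurungaleCastellaSkinner2025] Thm. 4.2.1 (b), p. 5 (the `p = 3` gap).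
-/

noncomputable section

open scoped Classical Topology

set_option linter.dupNamespace false
set_option autoImplicit false

namespace Summit.BirchSwinnertonDyer.BirchSwinnertonDyer.Theorems.UniversalToricDescentTwinSplit

open Filter PowerSeries WeierstrassCurve NumberField IsDedekindDomain Field
  Literature.NumberTheory.EllipticCurves
  Literature.NumberTheory.EllipticCurves.ModularForms
  Literature.NumberTheory.EllipticCurves.Rank1Residual
  Literature.NumberTheory.GaloisRepresentations
  Summit.BirchSwinnertonDyer.Rank1Residual
  Summit.BirchSwinnertonDyer.Rank1Residual.X11b
  Summit.BirchSwinnertonDyer.Rank1Residual.X11b.Halves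
  Summit.BirchSwinnertonDyer.BirchSwinnertonDyer.Theorems.CongruentShaFreeCutCharacterSupply
  Summit.BirchSwinnertonDyer.BirchSwinnertonDyer.Theorems.CongruentShaFreeCutBDPUpToSeriesRigidity
open Summit.BirchSwinnertonDyer.BirchSwinnertonDyer.Theorems.CongruentShaFreeCutUnrSeriesWeierstrass
  (coe_natCast_pow)

/-! ## §1 Integral cross-period rigidity: two frames generate the same ideal of `R₀⟦T⟧` -/

section AnyPrime

variable {p : ℕ} [hp : Fact p.Prime] {K : Type} [Field K] [NumberField K] {N : ℕ}
  {ι : PadicAlgCl p ≃+* ℂ} {𝔭 : HeightOneSpectrum (𝓞 K)} {κ : ZpExtension K p}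
  {γ : Field.absoluteGaloisGroup K} {f : CuspForm (CongruenceSubgroup.Gamma0 N) 2}
  {ΩK ΩK' : ℂ} {Ωp Ωp' : ℂ_[p]} {L L' : UnrSeries p}

/-- A unit `w` of `R₀⟦T⟧` has values of norm `1` on the open unit disc: `‖w(x) − w(0)‖ ≤ ‖x‖ < 1` and
`‖w(0)‖ = 1`. [folklore] -/
theorem norm_value_eq_one_of_isUnit {w : UnrSeries p} (hw : IsUnit w) {x ω : ℂ_[p]} (hx : ‖x‖ < 1)
    (hω : w.HasValueAt x ω) : ‖ω‖ = 1 := by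
  have hc : ‖((PowerSeries.constantCoeff w : unrIntegers p) : ℂ_[p])‖ = 1 :=
    (unrIntegers.isUnit_iff_norm_eq_one _).mp (PowerSeries.isUnit_constantCoeff w hw)
  have hlt : ‖ω - ((PowerSeries.constantCoeff w : unrIntegers p) : ℂ_[p])‖ <
      ‖((PowerSeries.constantCoeff w : unrIntegers p) : ℂ_[p])‖ := by
    rw [hc]; exact (norm_value_sub_constantCoeff_le hx hω).trans_lt hx
  calc ‖ω‖ = ‖(ω - ((PowerSeries.constantCoeff w : unrIntegers p) : ℂ_[p])) +
        ((PowerSeries.constantCoeff w : unrIntegers p) : ℂ_[p])‖ := by rw [sub_add_cancel]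
    _ = max ‖ω - ((PowerSeries.constantCoeff w : unrIntegers p) : ℂ_[p])‖
        ‖((PowerSeries.constantCoeff w : unrIntegers p) : ℂ_[p])‖ :=
          IsUltrametricDist.norm_add_eq_max_of_norm_ne_norm (ne_of_lt hlt)
    _ = 1 := by rw [max_eq_right hlt.le, hc]

/-- `0 < ‖p‖ < 1` in `ℂ_p`. [folklore] -/
theorem norm_natCast_p_pos_and_lt_one : 0 < ‖((p : ℕ) : ℂ_[p])‖ ∧ ‖((p : ℕ) : ℂ_[p])‖ < 1 := by
  have h : ‖((p : ℕ) : ℂ_[p])‖ = ‖((p : ℕ) : ℚ_[p])‖ := by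
    rw [← map_natCast (algebraMap ℚ_[p] ℂ_[p]) p, norm_algebraMap']
  rw [h]
  exact ⟨norm_pos_iff.mpr (by exact_mod_cast hp.out.ne_zero), Padic.norm_p_lt_one⟩

/-- **INTEGRAL CROSS-PERIOD RIGIDITY.** For `K` imaginary quadratic, `κ` anticyclotomic with topological
generator `γ`, and ANY non-zero periods `Ω_K, Ω′_K ∈ ℂ`, `Ω_p, Ω′_p ∈ ℂ_p`: two series `L, L′ ∈ R₀⟦T⟧`
carrying the BDP interpolation property of the same `(ι, 𝔭, κ, γ, f)` generate the SAME ideal of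
`R₀⟦T⟧`. (cn100's LEMMA R∞ gives `p^a L′ = p^b (w L)`; the exponents agree by evaluating at two
interpolation points where `L` does not vanish, since the frames' values differ by `β^n` with
`‖β‖^{m p^k}` forced to be `1`, and a unit has values of norm `1`.) Any prime `p`.
[cite: Castella2018, Thm. 3.1 (arXiv:1704.06608 p. 9)] [cite: Washington1997, §7.1–7.2 (Weierstrass preparation behind R∞)] -/
theorem span_singleton_eq_of_isBDPLFunction (hK : IsImaginaryQuadratic K) (hκ : κ.IsAnticyclotomic)
    (hγ : κ.IsTopGenerator γ) (hΩK : ΩK ≠ 0) (hΩK' : ΩK' ≠ 0) (hΩp : Ωp ≠ 0) (hΩp' : Ωp' ≠ 0)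
    (hL : IsBDPLFunction ι 𝔭 κ γ f ΩK Ωp L) (hL' : IsBDPLFunction ι 𝔭 κ γ f ΩK' Ωp' L') :
    Ideal.span ({L'} : Set (UnrSeries p)) = Ideal.span {L} := by
  by_cases h0 : L = 0
  · have h0' : L' = 0 :=
      (eq_zero_iff_of_isBDPLFunctionUpTo hK hκ hγ hΩK hΩK' hΩp hΩp' one_ne_zero one_ne_zero
        hL.upTo_one hL'.upTo_one).mp h0
    rw [h0, h0']
  -- R∞ : `p^a L' = p^b (w L)`
  obtain ⟨a, b, w, hw, hrel⟩ := seriesRigidity_of_isBDPLFunctionUpTo hK hκ hγ hΩK hΩK' hΩp hΩp'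
    one_ne_zero one_ne_zero hL.upTo_one hL'.upTo_one
  -- the supply of interpolation characters
  obtain ⟨m, x₀, φ, φ', r, r', hm, hx1, hx, hunr, hinf, hr, hrκ, hval, -, -, -, -, -⟩ :=
    characterSupplyAt (p := p) K ι κ γ hK hκ hγ
  set x : ℕ → ℂ_[p] := fun k ↦ x₀ ^ p ^ k - 1 with hxdef
  have hT0 : Tendsto x atTop (𝓝 0) := by
    have := hx.sub_const 1
    simpa [hxdef] using this
  have hnpos : ∀ k, 0 < m * p ^ k := fun k ↦ Nat.mul_pos hm (pow_pos hp.out.pos _)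
  -- the values of the two frames at `x k`
  set V : ℕ → ℂ_[p] := fun k ↦
    ((ι.symm (bdpInterpolationValue p f 𝔭 (φ k) (m * p ^ k) ΩK) : PadicAlgCl p) : ℂ_[p]) *
      Ωp ^ (4 * (m * p ^ k)) with hVdef
  set β : ℂ_[p] := ((ι.symm ((ΩK / ΩK') ^ 4) : PadicAlgCl p) : ℂ_[p]) * (Ωp' / Ωp) ^ 4 with hβdef
  have hLval : ∀ k, L.HasValueAt (x k) (V k) := fun k ↦ by
    have h := hL.hasValueAt (hnpos k) (hunr k) (hinf k) (hr k) (hrκ k)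
    rwa [hval] at h
  have hL'val : ∀ k, L'.HasValueAt (x k) (V k * β ^ (m * p ^ k)) := fun k ↦ by
    have h := hasValueAt_frame_rescale hΩK hΩK' hΩp hL' (hnpos k) (hunr k) (hinf k) (hr k) (hrκ k)
    rwa [hval] at h
  -- eventually `‖x k‖ < 1`
  have hev : ∀ᶠ k in atTop, ‖x k‖ < 1 := by
    have h := hT0.norm
    rw [norm_zero] at h
    exact h.eventually (gt_mem_nhds zero_lt_one)
  -- `V k ≠ 0` frequently (identity principle: otherwise `L = 0`)
  have hfreq : ∃ᶠ k in atTop, V k ≠ 0 := by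
    by_contra hcon
    have hV : ∀ᶠ k in atTop, V k = 0 := by simpa [Filter.not_frequently] using hcon
    obtain ⟨K₁, hK₁⟩ := eventually_atTop.mp hV
    apply h0
    refine unrSeries_eq_of_hasValueAt (x := fun k ↦ x (k + K₁)) (v := fun _ ↦ 0)
      (hT0.comp (tendsto_add_atTop_nat K₁))
      (Frequently.of_forall fun k ↦ sub_ne_zero.mpr (hx1 _)) (fun k ↦ ?_)
      (fun k ↦ hasValueAt_zero_series _)
    have h := hLval (k + K₁)
    rwa [hK₁ (k + K₁) (Nat.le_add_left K₁ k)] at h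
  -- norms of the constants
  obtain ⟨hp0, hp1⟩ := norm_natCast_p_pos_and_lt_one (p := p)
  have hcoe : ∀ c : ℕ, ((((p : ℕ) : unrIntegers p) ^ c : unrIntegers p) : ℂ_[p]) =
      ((p : ℕ) : ℂ_[p]) ^ c := fun c ↦ coe_natCast_pow c
  -- at a good index: `‖p‖^a ‖β‖^{m p^k} = ‖p‖^b`
  have hE : ∀ k, ‖x k‖ < 1 → V k ≠ 0 →
      ‖((p : ℕ) : ℂ_[p])‖ ^ a * ‖β‖ ^ (m * p ^ k) = ‖((p : ℕ) : ℂ_[p])‖ ^ b := by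
    intro k hxk hVk
    obtain ⟨ω, hω⟩ := exists_hasValueAt w hxk
    have hω1 : ‖ω‖ = 1 := norm_value_eq_one_of_isUnit hw hxk hω
    -- values of the two sides of `hrel` at `x k`
    have hlhs : UnrSeries.HasValueAt (PowerSeries.C (((p : ℕ) : unrIntegers p) ^ a) * L') (x k)
        ((((p : ℕ) : ℂ_[p]) ^ a) * (V k * β ^ (m * p ^ k))) := by
      rw [← hcoe]; exact hasValueAt_C_mul _ (hL'val k)
    have hrhs : UnrSeries.HasValueAt (PowerSeries.C (((p : ℕ) : unrIntegers p) ^ b) * (w * L)) (x k)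
        ((((p : ℕ) : ℂ_[p]) ^ b) * (ω * V k)) := by
      rw [← hcoe]; exact hasValueAt_C_mul _ (hasValueAt_mul hxk hω (hLval k))
    rw [hrel] at hlhs
    have heq : (((p : ℕ) : ℂ_[p]) ^ a) * (V k * β ^ (m * p ^ k)) =
        (((p : ℕ) : ℂ_[p]) ^ b) * (ω * V k) := hlhs.unique hrhs
    have hn := congrArg (‖·‖) heq
    simp only [norm_mul, norm_pow, hω1, one_mul] at hn
    -- cancel `‖V k‖ ≠ 0`
    have hV0 : ‖V k‖ ≠ 0 := norm_ne_zero_iff.mpr hVk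
    have : ‖((p : ℕ) : ℂ_[p])‖ ^ a * ‖β‖ ^ (m * p ^ k) * ‖V k‖ =
        ‖((p : ℕ) : ℂ_[p])‖ ^ b * ‖V k‖ := by
      rw [← hn]; ring
    exact mul_right_cancel₀ hV0 this
  -- two good indices `k₁ < k₂`
  have hgood : ∃ᶠ k in atTop, ‖x k‖ < 1 ∧ V k ≠ 0 := (hfreq.and_eventually hev).mono fun k h ↦ h.symm
  obtain ⟨k₁, hx₁, hV₁⟩ := hgood.exists
  obtain ⟨k₂, hk₂, hx₂, hV₂⟩ := (frequently_atTop.mp hgood) (k₁ + 1)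
  have hE₁ := hE k₁ hx₁ hV₁
  have hE₂ := hE k₂ (by exact hx₂) hV₂
  -- `‖β‖^{m p^{k₁}} = 1`
  set y : ℝ := ‖β‖ ^ (m * p ^ k₁) with hydef
  have hy0 : 0 ≤ y := pow_nonneg (norm_nonneg _) _
  have hpa : 0 < ‖((p : ℕ) : ℂ_[p])‖ ^ a := pow_pos hp0 a
  have hyy : y ^ p ^ (k₂ - k₁) = y := by
    have h12 : ‖β‖ ^ (m * p ^ k₂) = y ^ p ^ (k₂ - k₁) := by
      rw [hydef, ← pow_mul]
      congr 1
      rw [mul_assoc, ← pow_add, Nat.add_sub_cancel' (by omega : k₁ ≤ k₂)]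
    have := hE₂
    rw [h12, ← hE₁] at this
    exact mul_left_cancel₀ hpa.ne' this
  have hy1 : y = 1 := by
    have hyne : y ≠ 0 := by
      intro hy
      rw [hy, mul_zero] at hE₁
      exact (pow_pos hp0 b).ne hE₁
    have he : 1 ≤ p ^ (k₂ - k₁) - 1 := by
      have : 2 ≤ p ^ (k₂ - k₁) := by
        calc 2 ≤ p := hp.out.two_le
          _ = p ^ 1 := (pow_one p).symm
          _ ≤ p ^ (k₂ - k₁) := Nat.pow_le_pow_right hp.out.pos (by omega)
      omega
    have hsplit : y ^ p ^ (k₂ - k₁) = y ^ (p ^ (k₂ - k₁) - 1) * y := by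
      rw [← pow_succ, Nat.sub_add_cancel (by omega : 1 ≤ p ^ (k₂ - k₁))]
    rw [hsplit] at hyy
    have hpow : y ^ (p ^ (k₂ - k₁) - 1) = 1 := by
      have : y ^ (p ^ (k₂ - k₁) - 1) * y = 1 * y := by rw [hyy, one_mul]
      exact mul_right_cancel₀ hyne this
    exact (pow_eq_one_iff_of_nonneg hy0 (by omega)).mp hpow
  -- hence `a = b`
  have hab : a = b := by
    rw [hy1, mul_one] at hE₁
    exact pow_right_injective₀ hp0 hp1.ne hE₁
  -- cancel `p^a` : `L' = w L`
  rw [hab] at hrel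
  have hC0 : PowerSeries.C (((p : ℕ) : unrIntegers p) ^ b) ≠ (0 : UnrSeries p) := by
    intro hC
    have h1 : (((p : ℕ) : unrIntegers p) ^ b : unrIntegers p) = 0 := by
      have := congrArg PowerSeries.constantCoeff hC
      simpa using this
    have h2 : ((((p : ℕ) : unrIntegers p) ^ b : unrIntegers p) : ℂ_[p]) = 0 := by
      rw [h1]; rfl
    rw [hcoe] at h2
    exact (pow_pos hp0 b).ne' (by rw [← norm_pow, h2, norm_zero])
  have hLw : L' = w * L := mul_left_cancel₀ hC0 hrel
  rw [hLw]
  exact Ideal.span_singleton_mul_left_unit hw L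

/-! ## §2 Consequences for clause (ii): one frame ⇒ every frame -/

/-- **Membership transfer across frames.** If ONE frame's series lies in an ideal `I` of `R₀⟦T⟧`, then
EVERY frame's series (arbitrary non-zero periods) lies in `I`. [cite: Castella2018, Thm. 3.1 (arXiv:1704.06608 p. 9)] -/
theorem mem_of_frame_of_frame (hK : IsImaginaryQuadratic K) (hκ : κ.IsAnticyclotomic)
    (hγ : κ.IsTopGenerator γ) (hΩK : ΩK ≠ 0) (hΩK' : ΩK' ≠ 0) (hΩp : Ωp ≠ 0) (hΩp' : Ωp' ≠ 0)
    (hL : IsBDPLFunction ι 𝔭 κ γ f ΩK Ωp L) (hL' : IsBDPLFunction ι 𝔭 κ γ f ΩK' Ωp' L')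
    {I : Ideal (UnrSeries p)} (hmem : L ∈ I) : L' ∈ I := by
  have h := span_singleton_eq_of_isBDPLFunction hK hκ hγ hΩK hΩK' hΩp hΩp' hL hL'
  have : L' ∈ Ideal.span ({L} : Set (UnrSeries p)) := by
    rw [← h]; exact Ideal.mem_span_singleton_self L'
  exact (Ideal.span_singleton_le_iff_mem I).mpr hmem this

/-- **Identity transfer across frames.** If `I = (L)` for ONE frame, then `I = (L′)` for EVERY frame.
[cite: Castella2018, Thm. 3.1 (arXiv:1704.06608 p. 9)] -/
theorem eq_span_of_frame_of_frame (hK : IsImaginaryQuadratic K) (hκ : κ.IsAnticyclotomic)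
    (hγ : κ.IsTopGenerator γ) (hΩK : ΩK ≠ 0) (hΩK' : ΩK' ≠ 0) (hΩp : Ωp ≠ 0) (hΩp' : Ωp' ≠ 0)
    (hL : IsBDPLFunction ι 𝔭 κ γ f ΩK Ωp L) (hL' : IsBDPLFunction ι 𝔭 κ γ f ΩK' Ωp' L')
    {I : Ideal (UnrSeries p)} (heq : I = Ideal.span {L}) : I = Ideal.span {L'} := by
  rw [heq, span_singleton_eq_of_isBDPLFunction hK hκ hγ hΩK hΩK' hΩp hΩp' hL hL']

/-- **Inclusion transfer across frames.** If `I ⊆ (L)` for ONE frame, then `I ⊆ (L′)` for EVERY frame.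
[cite: Castella2018, Thm. 3.1 (arXiv:1704.06608 p. 9)] -/
theorem le_span_of_frame_of_frame (hK : IsImaginaryQuadratic K) (hκ : κ.IsAnticyclotomic)
    (hγ : κ.IsTopGenerator γ) (hΩK : ΩK ≠ 0) (hΩK' : ΩK' ≠ 0) (hΩp : Ωp ≠ 0) (hΩp' : Ωp' ≠ 0)
    (hL : IsBDPLFunction ι 𝔭 κ γ f ΩK Ωp L) (hL' : IsBDPLFunction ι 𝔭 κ γ f ΩK' Ωp' L')
    {I : Ideal (UnrSeries p)} (hle : I ≤ Ideal.span {L}) : I ≤ Ideal.span {L'} := by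
  rwa [span_singleton_eq_of_isBDPLFunction hK hκ hγ hΩK hΩK' hΩp hΩp' hL hL']

/-- **`∃`-frame ⇒ `∀`-frame for an identity of ideals** (the shape of clause (ii) of crux #3 and of the
hypothesis/conclusion of crux #2 `ToricTransportModThree`): if SOME frame `(Ω_K ≠ 0, Ω_p ≠ 0, L)` has
`I = (L)`, then EVERY frame has it. So the universal quantification over frames in those clauses costs
exactly one frame. [cite: Castella2018, Thm. 3.1 (arXiv:1704.06608 p. 9)] -/
theorem forall_frame_eq_span_of_exists (hK : IsImaginaryQuadratic K) (hκ : κ.IsAnticyclotomic)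
    (hγ : κ.IsTopGenerator γ) {I : Ideal (UnrSeries p)}
    (hex : ∃ (ΩK : ℂ) (Ωp : ℂ_[p]) (L : UnrSeries p), ΩK ≠ 0 ∧ Ωp ≠ 0 ∧
      IsBDPLFunction ι 𝔭 κ γ f ΩK Ωp L ∧ I = Ideal.span {L}) :
    ∀ (ΩK' : ℂ) (Ωp' : ℂ_[p]) (L' : UnrSeries p), ΩK' ≠ 0 → Ωp' ≠ 0 →
      IsBDPLFunction ι 𝔭 κ γ f ΩK' Ωp' L' → I = Ideal.span {L'} := by
  intro ΩK' Ωp' L' hΩK' hΩp' hL'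
  obtain ⟨ΩK, Ωp, L, hΩK, hΩp, hL, heq⟩ := hex
  exact eq_span_of_frame_of_frame hK hκ hγ hΩK hΩK' hΩp hΩp' hL hL' heq

end AnyPrime

end Summit.BirchSwinnertonDyer.BirchSwinnertonDyer.Theorems.UniversalToricDescentTwinSplit

end
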